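import Summits.Ventures.CertifiedQuantumChemistry.Rows.CIEnergySymmetric
import Mathlib.Data.Nat.Factorization.Basic
import HarnessLib

/-!
# Ventures/CertifiedQuantumChemistry — Rows/OccupationBitmasks.lean: occupation-number vectors as natural-number bit masks
# (the dictionary between `Finset (Orb (Fin k))` and GMP-accelerated bit operations, for fast kernel evaluation)

HONEST FRAMING (verbatim): certified bounds for a stated model Hamiltonian in a stated basis; not a
claim about the real molecule beyond that model.

var-2 (gen 16), zero compute, PROVED glue only (0 sorry, no claim node; nothing here asserts a bound about any model).
The kernel evaluates the Slater–Condon mirror `Model.slaterCondon F I J` of `Rows/CIUpperBound.lean` on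
`I J : Finset (Orb (Fin k))` by unfolding finite-set operations over `Fin k ×ₗ Fin 2` — measured ≈ 40 ms per
determinant pair at `k = 6` (`Rows/CIEnergySymmetric.lean`), which puts the `(4,4)` sector of the `k = 8` files
(4 900 determinants) out of reach. The Lean 4 kernel has GMP-accelerated `Nat` arithmetic and bit operations
(`&&&`, `|||`, `^^^`, `>>>`, `%`, `/`, `Nat.beq`, `Nat.ble`; measured ≈ 7 μs per operation on the farm), so an
occupation-number vector is better presented to it as ONE natural number `m < 4^k` with bit `2p + σ` set iff spin
orbital `(p, σ)` is occupied (`σ = 0` up, `1` down; this is the position of `(p, σ)` in the lexicographic order of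
`Orb (Fin k)`, so Jordan–Wigner counts are pop-counts of low bit segments). This file is the dictionary:

* `bitSet m B` (positions `< B` of the set bits), its byte split `card_bitSet_split`, and the POPCOUNT `pc24 m` of a
  `m < 2^24` by three look-ups in a packed 256-entry byte table (`pc8`, table proved entry by entry by `decide`):
  `card_bitSet_eq_pc24`.
* `lowBit x = x XOR-free lowest set bit` (`x − (x &&& (x − 1))`, two GMP operations): for `x = 2^(j+1) c + 2^j`,
  `lowBit x = 2^j` (`lowBit_of_decomp`; every `x ≠ 0` has this form, `exists_decomp`), the bit pattern of such an
  `x` (`testBit_decomp`), and `IsPow2`-style consequences: `x ≠ 0 ∧ lowBit x = x ↔ x` has exactly one bit.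
* `idx24 v` — the exponent of a power of two `v < 2^24` by byte-table look-up (`idx24_two_pow`, by `decide`).
* `sumPos s g n` — `Σ_{q < n, bit q set} g q` as a structural position loop (`sumPos_eq_sum_bitSet`).

This is PART 1 (pure bit arithmetic, no orbitals). PART 2 = `Rows/OccupationVectorMasks.lean` (`pos P = 2p + σ`,
`onv k m : Finset (Orb (Fin k))`, Jordan–Wigner filters, `min'`/`max'`, sums over `onv`); the bit-level Slater–Condon
evaluator proved equal to `Model.slaterCondon` is `Rows/SlaterCondonFast.lean`.
-/

namespace Summit.Ventures.CertifiedQuantumChemistry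

open Finset
open Literature.MathematicalPhysics.QuantumLattice Literature.MathematicalPhysics.QuantumChemistry

namespace Onv

/-! ## Bit sets and the byte-table popcount -/

/-- The positions `< B` of the set bits of `m`. -/
def bitSet (m B : ℕ) : Finset ℕ := (range B).filter fun i => m.testBit i

/-- Membership in `bitSet`. -/
theorem mem_bitSet {m B i : ℕ} : i ∈ bitSet m B ↔ i < B ∧ m.testBit i = true := by
  simp [bitSet]

/-- Above the size of `m` the bound does not matter. -/
theorem bitSet_eq_of_lt {m B B' : ℕ} (hm : m < 2 ^ B) (hB : B ≤ B') : bitSet m B' = bitSet m B := by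
  ext i
  simp only [mem_bitSet]
  constructor
  · rintro ⟨-, hi⟩
    refine ⟨?_, hi⟩
    by_contra h
    have : m.testBit i = false := Nat.testBit_lt_two_pow (lt_of_lt_of_le hm (Nat.pow_le_pow_right (by norm_num) (by omega)))
    rw [this] at hi
    exact Bool.false_ne_true hi
  · rintro ⟨h, hi⟩
    exact ⟨by omega, hi⟩

/-- `bitSet 0 B = ∅`. -/
theorem bitSet_zero (B : ℕ) : bitSet 0 B = ∅ := by
  ext i; simp [mem_bitSet]

/-- A number below `2^B` with no set bit below `B` is `0`. -/
theorem eq_zero_of_bitSet_eq_empty {m B : ℕ} (hm : m < 2 ^ B) (h : bitSet m B = ∅) : m = 0 := by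
  apply Nat.eq_of_testBit_eq
  intro i
  rw [Nat.zero_testBit]
  by_cases hi : i < B
  · by_contra hne
    have : i ∈ bitSet m B := mem_bitSet.2 ⟨hi, by simpa using hne⟩
    rw [h] at this
    exact absurd this (Finset.notMem_empty _)
  · exact Nat.testBit_lt_two_pow (lt_of_lt_of_le hm (Nat.pow_le_pow_right (by norm_num) (by omega)))

/-- Byte split of a bit set: the bits `< a + b` of `m` are the bits `< a` of `m % 2^a` and, shifted by `a`, the bits
`< b` of `m >>> a`. -/
theorem bitSet_split (m a b : ℕ) :
    bitSet m (a + b) = bitSet (m % 2 ^ a) a ∪ (bitSet (m >>> a) b).map (addLeftEmbedding a) := by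
  ext i
  simp only [mem_bitSet, mem_union, mem_map, addLeftEmbedding_apply, Nat.testBit_mod_two_pow,
    Nat.testBit_shiftRight, Bool.and_eq_true, decide_eq_true_eq]
  constructor
  · rintro ⟨hi, ht⟩
    by_cases hia : i < a
    · exact Or.inl ⟨hia, hia, ht⟩
    · refine Or.inr ⟨i - a, ⟨by omega, ?_⟩, by omega⟩
      rwa [show a + (i - a) = i by omega]
  · rintro (⟨hia, -, ht⟩ | ⟨j, ⟨hj, ht⟩, rfl⟩)
    · exact ⟨by omega, ht⟩
    · exact ⟨by omega, ht⟩

/-- Cardinality version of the byte split. -/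
theorem card_bitSet_split (m a b : ℕ) :
    (bitSet m (a + b)).card = (bitSet (m % 2 ^ a) a).card + (bitSet (m >>> a) b).card := by
  rw [bitSet_split, card_union_of_disjoint, card_map]
  rw [Finset.disjoint_left]
  intro i hi hi'
  rw [mem_bitSet] at hi
  obtain ⟨j, -, rfl⟩ := mem_map.1 hi'
  simp only [addLeftEmbedding_apply] at hi
  omega

/-- Packed byte table: slot `i < 256` (4 bits) holds the number of set bits of `i`. -/
def pcTab : ℕ :=
  95125173855764218123276304889944061997689682402263585766959741291920687686033329201817409157123347502415384089435969498586180241031507595463600295898153685276653211633572815512294064538494957912327413386667662218713394765509704508661031522276467630197481635010039778342554499416459730172574551513689147646224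

/-- Popcount of a byte by table look-up (three GMP operations). -/
def pc8 (i : ℕ) : ℕ := (pcTab >>> (4 * i)) &&& 15

/-- The byte table is correct (256 cases, decided by the kernel). -/
theorem pc8_eq : ∀ i : Fin 256, pc8 i.val = (bitSet i.val 8).card := by decide +kernel

/-- Popcount of a number `< 2^24` by three byte look-ups. -/
def pc24 (m : ℕ) : ℕ := pc8 (m &&& 255) + pc8 ((m >>> 8) &&& 255) + pc8 (m >>> 16)

/-- `pc24 m` is the number of set bits of `m < 2^24`. -/
theorem card_bitSet_eq_pc24 {m : ℕ} (hm : m < 2 ^ 24) : (bitSet m 24).card = pc24 m := by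
  have h255 : (255 : ℕ) = 2 ^ 8 - 1 := by norm_num
  rw [show (24 : ℕ) = 8 + (8 + 8) from rfl, card_bitSet_split, card_bitSet_split, pc24]
  have e1 : pc8 (m &&& 255) = (bitSet (m % 2 ^ 8) 8).card := by
    rw [h255, Nat.and_two_pow_sub_one_eq_mod]
    exact pc8_eq ⟨m % 2 ^ 8, Nat.mod_lt _ (by norm_num)⟩
  have e2 : pc8 ((m >>> 8) &&& 255) = (bitSet ((m >>> 8) % 2 ^ 8) 8).card := by
    rw [h255, Nat.and_two_pow_sub_one_eq_mod]
    exact pc8_eq ⟨(m >>> 8) % 2 ^ 8, Nat.mod_lt _ (by norm_num)⟩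
  have hlt : m >>> 16 < 256 := by
    rw [Nat.shiftRight_eq_div_pow]
    exact Nat.div_lt_of_lt_mul (by simpa using hm)
  have e3 : pc8 (m >>> 16) = (bitSet ((m >>> 8) >>> 8) 8).card := by
    rw [← Nat.shiftRight_add]
    exact pc8_eq ⟨m >>> 16, hlt⟩
  rw [e1, e2, e3, Nat.add_assoc]

/-! ## The lowest set bit -/

/-- The lowest set bit of `x`, isolated: `x − (x &&& (x − 1))` (`= 2^j` for `x = 2^(j+1) c + 2^j`; `0` for `x = 0`). -/
def lowBit (x : ℕ) : ℕ := x - (x &&& (x - 1))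

/-- Every nonzero natural number is `2^(j+1) c + 2^j` (`j` = position of its lowest set bit). -/
theorem exists_decomp {x : ℕ} (hx : x ≠ 0) : ∃ j c : ℕ, x = 2 ^ (j + 1) * c + 2 ^ j := by
  obtain ⟨j, m, hm, rfl⟩ := Nat.exists_eq_two_pow_mul_odd hx
  obtain ⟨c, rfl⟩ := hm
  exact ⟨j, c, by ring⟩

/-- Bit pattern of `2^(j+1) c + 2^j`: bit `j` set, nothing below, the bits of `c` above. -/
theorem testBit_decomp (j c i : ℕ) :
    (2 ^ (j + 1) * c + 2 ^ j).testBit i = (decide (i = j) || (decide (j < i) && c.testBit (i - (j + 1)))) := by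
  rw [Nat.testBit_two_pow_mul_add c (Nat.pow_lt_pow_right (by norm_num) (Nat.lt_succ_self j)) i, Nat.testBit_two_pow]
  by_cases h1 : i < j + 1
  · rw [if_pos h1]
    by_cases h2 : j = i
    · subst h2; simp
    · have : ¬ i = j := fun h => h2 h.symm
      simp [h2, this, show ¬ j < i by omega]
  · rw [if_neg h1]
    simp [show ¬ i = j by omega, show j < i by omega]

/-- Bit pattern of the predecessor `2^(j+1) c + 2^j − 1 = 2^(j+1) c + (2^j − 1)`. -/
theorem testBit_decomp_pred (j c i : ℕ) :
    (2 ^ (j + 1) * c + 2 ^ j - 1).testBit i = (decide (i < j) || (decide (j < i) && c.testBit (i - (j + 1)))) := by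
  have hj : 0 < 2 ^ j := Nat.two_pow_pos j
  rw [show 2 ^ (j + 1) * c + 2 ^ j - 1 = 2 ^ (j + 1) * c + (2 ^ j - 1) by omega,
    Nat.testBit_two_pow_mul_add c (lt_of_lt_of_le (Nat.sub_lt hj zero_lt_one)
      (Nat.pow_le_pow_right (by norm_num) (Nat.le_succ j))) i, Nat.testBit_two_pow_sub_one]
  by_cases h1 : i < j + 1
  · rw [if_pos h1]
    by_cases h2 : i < j
    · simp [h2]
    · simp [h2, show ¬ j < i by omega]
  · rw [if_neg h1]
    simp [show ¬ i < j by omega, show j < i by omega]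

/-- Clearing the lowest set bit: `x &&& (x − 1) = 2^(j+1) c` for `x = 2^(j+1) c + 2^j`. -/
theorem land_pred_of_decomp (j c : ℕ) :
    (2 ^ (j + 1) * c + 2 ^ j) &&& (2 ^ (j + 1) * c + 2 ^ j - 1) = 2 ^ (j + 1) * c := by
  apply Nat.eq_of_testBit_eq
  intro i
  rw [Nat.testBit_and, testBit_decomp, testBit_decomp_pred, Nat.testBit_two_pow_mul]
  by_cases h1 : i = j
  · subst h1; simp
  · by_cases h2 : j < i
    · simp [h1, h2, show ¬ i < j by omega, show i ≥ j + 1 by omega]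
    · simp [h1, h2, show ¬ i ≥ j + 1 by omega]

/-- `lowBit (2^(j+1) c + 2^j) = 2^j`. -/
theorem lowBit_of_decomp (j c : ℕ) : lowBit (2 ^ (j + 1) * c + 2 ^ j) = 2 ^ j := by
  rw [lowBit, land_pred_of_decomp, Nat.add_sub_cancel_left]

/-- `lowBit 0 = 0`. -/
theorem lowBit_zero : lowBit 0 = 0 := by simp [lowBit]

/-- Removing the lowest set bit by `^^^`: `(2^(j+1) c + 2^j) ^^^ 2^j = 2^(j+1) c`. -/
theorem decomp_xor_low (j c : ℕ) : (2 ^ (j + 1) * c + 2 ^ j) ^^^ 2 ^ j = 2 ^ (j + 1) * c := by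
  apply Nat.eq_of_testBit_eq
  intro i
  rw [Nat.testBit_xor, testBit_decomp, Nat.testBit_two_pow, Nat.testBit_two_pow_mul]
  by_cases h1 : i = j
  · subst h1; simp
  · by_cases h2 : j < i
    · simp [h1, Ne.symm h1, h2, show i ≥ j + 1 by omega]
    · simp [h1, Ne.symm h1, h2, show ¬ i ≥ j + 1 by omega]

/-- A nonzero `x` is a power of two iff `lowBit x = x`; then `x = 2^j` with `lowBit`'s exponent. -/
theorem eq_two_pow_of_lowBit_eq {x : ℕ} (hx : x ≠ 0) (h : lowBit x = x) : ∃ j : ℕ, x = 2 ^ j := by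
  obtain ⟨j, c, rfl⟩ := exists_decomp hx
  rw [lowBit_of_decomp] at h
  exact ⟨j, h.symm⟩

/-- `lowBit (2^j) = 2^j`. -/
theorem lowBit_two_pow (j : ℕ) : lowBit (2 ^ j) = 2 ^ j := by
  simpa using lowBit_of_decomp j 0

/-- The bit set of `2^(j+1) c + 2^j` below a bound `B > j`: `j` together with the shifted bits of `c`. -/
theorem bitSet_decomp (j c B : ℕ) (hj : j < B) :
    bitSet (2 ^ (j + 1) * c + 2 ^ j) B = insert j ((bitSet c (B - (j + 1))).map (addLeftEmbedding (j + 1))) := by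
  ext i
  simp only [mem_bitSet, testBit_decomp, mem_insert, mem_map, addLeftEmbedding_apply, Bool.or_eq_true,
    decide_eq_true_eq, Bool.and_eq_true]
  constructor
  · rintro ⟨hi, h | ⟨hji, ht⟩⟩
    · exact Or.inl h
    · exact Or.inr ⟨i - (j + 1), ⟨by omega, ht⟩, by omega⟩
  · rintro (rfl | ⟨l, ⟨hl, ht⟩, rfl⟩)
    · exact ⟨hj, Or.inl rfl⟩
    · exact ⟨by omega, Or.inr ⟨by omega, by simpa using ht⟩⟩

/-- Cardinality of the bit set of `2^(j+1) c + 2^j` (all bits below `B`). -/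
theorem card_bitSet_decomp (j c B : ℕ) (hj : j < B) :
    (bitSet (2 ^ (j + 1) * c + 2 ^ j) B).card = (bitSet c (B - (j + 1))).card + 1 := by
  rw [bitSet_decomp j c B hj, card_insert_of_notMem, card_map]
  intro h
  obtain ⟨l, -, hl⟩ := mem_map.1 h
  simp only [addLeftEmbedding_apply] at hl
  omega

/-- If `2^(j+1) c + 2^j < 2^B` then `j < B` and `c < 2^(B − (j+1))`. -/
theorem decomp_bounds {j c B : ℕ} (h : 2 ^ (j + 1) * c + 2 ^ j < 2 ^ B) : j < B ∧ c < 2 ^ (B - (j + 1)) := by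
  have hj : j < B := by
    by_contra hc
    have : 2 ^ B ≤ 2 ^ j := Nat.pow_le_pow_right (by norm_num) (by omega)
    have := Nat.two_pow_pos B
    omega
  refine ⟨hj, ?_⟩
  by_contra hc
  rw [not_lt] at hc
  have h1 : 2 ^ B = 2 ^ (j + 1) * 2 ^ (B - (j + 1)) := by rw [← pow_add]; congr 1; omega
  have h2 : 2 ^ (j + 1) * 2 ^ (B - (j + 1)) ≤ 2 ^ (j + 1) * c := Nat.mul_le_mul_left _ hc
  have := Nat.two_pow_pos j
  omega

/-- The bit set of a power of two. -/
theorem bitSet_two_pow {j B : ℕ} (hj : j < B) : bitSet (2 ^ j) B = {j} := by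
  have h := bitSet_decomp j 0 B hj
  simp only [mul_zero, zero_add, bitSet_zero, map_empty, insert_empty_eq] at h
  exact h

/-- ONE set bit: for `0 < x < 2^B`, `(bitSet x B).card = 1 ↔ lowBit x = x`. -/
theorem card_bitSet_eq_one_iff {x B : ℕ} (hx : x ≠ 0) (hB : x < 2 ^ B) : (bitSet x B).card = 1 ↔ lowBit x = x := by
  obtain ⟨j, c, rfl⟩ := exists_decomp hx
  obtain ⟨hj, hc⟩ := decomp_bounds hB
  rw [card_bitSet_decomp j c B hj, lowBit_of_decomp, Nat.add_eq_right, card_eq_zero]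
  constructor
  · intro h
    rw [eq_zero_of_bitSet_eq_empty hc h]; simp
  · intro h
    have : c = 0 := by
      have h2 : 2 ^ (j + 1) * c = 0 := by omega
      simpa using h2
    subst this
    exact bitSet_zero _

/-- The bits of `2^(j+1) c` below `B` are the bits of `c` below `B − (j+1)`, shifted. -/
theorem bitSet_two_pow_succ_mul (j c B : ℕ) :
    bitSet (2 ^ (j + 1) * c) B = (bitSet c (B - (j + 1))).map (addLeftEmbedding (j + 1)) := by
  ext i
  rw [mem_bitSet, mem_map, Nat.testBit_two_pow_mul, Bool.and_eq_true, decide_eq_true_eq]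
  constructor
  · rintro ⟨hi, hge, ht⟩
    refine ⟨i - (j + 1), mem_bitSet.2 ⟨by omega, ht⟩, ?_⟩
    rw [addLeftEmbedding_apply]; omega
  · rintro ⟨l, hl, hli⟩
    rw [addLeftEmbedding_apply] at hli
    obtain ⟨hl, ht⟩ := mem_bitSet.1 hl
    refine ⟨by omega, by omega, ?_⟩
    rw [show i - (j + 1) = l by omega]; exact ht

/-- After removing the lowest bit (`x ^^^ lowBit x = 2^(j+1) c` for `x = 2^(j+1) c + 2^j`):
`(bitSet (x ^^^ lowBit x) B).card + 1 = (bitSet x B).card` for `0 < x < 2^B`. -/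
theorem card_bitSet_xor_lowBit {x B : ℕ} (hx : x ≠ 0) (hB : x < 2 ^ B) :
    (bitSet (x ^^^ lowBit x) B).card + 1 = (bitSet x B).card := by
  obtain ⟨j, c, rfl⟩ := exists_decomp hx
  obtain ⟨hj, -⟩ := decomp_bounds hB
  rw [lowBit_of_decomp, decomp_xor_low, card_bitSet_decomp j c B hj, bitSet_two_pow_succ_mul, card_map]

/-- `x ^^^ lowBit x < 2^B` when `x < 2^B`. -/
theorem xor_lowBit_lt {x B : ℕ} (hB : x < 2 ^ B) : x ^^^ lowBit x < 2 ^ B := by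
  refine Nat.xor_lt_two_pow hB (lt_of_le_of_lt ?_ hB)
  unfold lowBit; omega

/-- TWO set bits: for `0 < x < 2^B` with `lowBit x ≠ x`, `(bitSet x B).card = 2 ↔ lowBit (x ^^^ lowBit x) = x ^^^ lowBit x`. -/
theorem card_bitSet_eq_two_iff {x B : ℕ} (hx : x ≠ 0) (hB : x < 2 ^ B) (hne : lowBit x ≠ x) :
    (bitSet x B).card = 2 ↔ lowBit (x ^^^ lowBit x) = x ^^^ lowBit x := by
  have hx2 : x ^^^ lowBit x ≠ 0 := by
    intro h
    have : x = lowBit x := by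
      have := congrArg (· ^^^ lowBit x) h
      simpa [Nat.xor_assoc, Nat.xor_self] using this
    exact hne this.symm
  rw [← card_bitSet_xor_lowBit hx hB, show (2 : ℕ) = 1 + 1 from rfl, Nat.add_right_cancel_iff]
  exact card_bitSet_eq_one_iff hx2 (xor_lowBit_lt hB)

/-! ## The exponent of a power of two by table look-up -/

/-- Packed byte table: slot `2^j` (`j < 8`, 3 bits) holds `j`. -/
def idxTab : ℕ :=
  25022362156799035803914582955757619369568891729402897373840142026534261798713521414930642828909913299323807825150831116622313716821879120336814099329813250252251674145805210015125924716975068986259343685912095266900480122950000704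

/-- Exponent of a one-byte power of two. -/
def idx8 (v : ℕ) : ℕ := (idxTab >>> (3 * v)) &&& 7

/-- Exponent of a power of two `< 2^24` (byte-table look-ups; a handful of GMP operations). -/
def idx24 (v : ℕ) : ℕ :=
  if v < 256 then idx8 v else if v < 65536 then 8 + idx8 (v >>> 8) else 16 + idx8 (v >>> 16)

/-- `idx24 (2^j) = j` for `j < 24` (decided). -/
theorem idx24_two_pow : ∀ j : Fin 24, idx24 (2 ^ j.val) = j.val := by decide +kernel

/-! ## Position loops -/

/-- `Σ_{q < n, bit q of s set} g q`, by structural recursion on `n` (one `testBit` per position in the kernel). -/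
def sumPos (s : ℕ) (g : ℕ → ℤ) : ℕ → ℤ
  | 0 => 0
  | n + 1 => sumPos s g n + if s.testBit n then g n else 0

/-- The position loop is the sum over the bit set. -/
theorem sumPos_eq_sum_bitSet (s : ℕ) (g : ℕ → ℤ) (n : ℕ) : sumPos s g n = ∑ q ∈ bitSet s n, g q := by
  induction n with
  | zero => simp [sumPos, bitSet]
  | succ n ih =>
    rw [sumPos, ih, bitSet, bitSet, Finset.range_add_one, filter_insert]
    split_ifs with h
    · rw [sum_insert (by simp), add_comm]
    · rw [add_zero]

end Onv

end Summit.Ventures.CertifiedQuantumChemistry
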